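import Summits.AnomalousDissipation.AnomalousDissipation.Theses.BaireTransfer

/-!
# AnomalousDissipation / BaireTransfer — assembly item `Assembly`

Route `AnomalousDissipation/BaireTransfer`, item stmt-AnomalousDissipation-10623 (`Assembly`, rank 1):
the deciding implication of the route,
`DenseLoudDesignerForces → RobustLoudUpgrade → DensityGlue → BaireStep → AnomalousDissipation`.

Proof (three lines, the same term as the route file's deciding theorem `closes`): the two ranked
cruxes give the Baire target through the support item `DensityGlue`, and `BaireStep` turns the target
into ONE steady smooth divergence-free mean-zero force `f` carrying, along viscosities `ν j → 0`,
time-periodic global classical Navier–Stokes solutions `u j` with bounded mean energy and mean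
dissipation `≥ ε > 0` (the thesis of route CoherentStates, stmt-AnomalousDissipation-0218, verbatim).
Each global classical solution is a global Leray–Hopf solution from its time-zero slice `u j 0` by the
DISCHARGED Literature fact `Literature.Analysis.FluidPDE.Torus.isGlobalLerayHopf_of_isClassicalNSSolutionOn`
(used through `IsClassicalNSSolutionOn.isGlobalLerayHopf`, file
`Literature/Analysis/FluidPDE/TorusClassicalLerayHopfProofs.lean`; Robinson–Rodrigo–Sadowski 2016
Thm 6.5, Galdi 2000 Thm 4.1), so it is USED, not assumed; the energy / dissipation clauses are those of
`AnomalousDissipation = Literature.Turb.ZerothLaw` verbatim (Doering–Foias 2002 §2).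

Nothing else is used; in particular no estimate uniform in `ν`.
-/

-- `Summit.<Summit>.<Problem>` is the tree's mandated summit-side namespace (CONVENTIONS §2); for this
-- single-conjunct summit the two coincide, so the duplicate is deliberate.
set_option linter.dupNamespace false

namespace Summit.AnomalousDissipation.AnomalousDissipation.Theorems

open Summit.AnomalousDissipation.AnomalousDissipation.Theses.BaireTransfer

/-- Settles stmt-AnomalousDissipation-10623 (assembly item `Assembly` of route BaireTransfer):
`DenseLoudDesignerForces → RobustLoudUpgrade → DensityGlue → BaireStep → AnomalousDissipation`.
From `BaireStep (DensityGlue h₂ h₃)` take the force `f`, the viscosities `ν j → 0` and the periodic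
classical solutions `u j`; the Leray–Hopf witnesses of `AnomalousDissipation` are `u j` from the data
`u j 0`, by `IsClassicalNSSolutionOn.isGlobalLerayHopf` (the discharged fact
`Literature.Analysis.FluidPDE.Torus.isGlobalLerayHopf_of_isClassicalNSSolutionOn`); energy and
dissipation bounds are carried over unchanged. [folklore] -/
theorem baireTransferAssembly_proof :
    Summit.AnomalousDissipation.AnomalousDissipation.Theses.BaireTransfer.Assembly := by
  unfold Assembly
  intro h₂ h₃ hg hb
  -- the Baire target from the two cruxes, then one fixed force with loud periodic classical solutions
  obtain ⟨f, hf, hdiv, hmean, ν, τ, u, p, hν, hν0, hsol, hE, hε⟩ := hb (hg h₂ h₃)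
  -- classical ⇒ Leray–Hopf from the time-zero slice (discharged Literature fact), clauses verbatim
  exact ⟨f, hf, hdiv, hmean, ν, fun j => u j 0, u, hν, hν0, fun j => (hsol j).1.isGlobalLerayHopf,
    hE, hε⟩

end Summit.AnomalousDissipation.AnomalousDissipation.Theorems
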